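import Summits.BirchSwinnertonDyer.Rank1Residual.GaloisImage.ModPLatticeHerbrandCount
import HarnessLib

/-!
# Milne's Lemma I 2.12, iterated: `#Hom_G(Z, V/p) = #Hom_G(Z, W/p)` for `p^N V ≤ W ≤ V`, `V[p] = 0`
# (cell `b2b-bsdres`, team n1011, row T-EPC = Tate's local Euler–Poincaré characteristic; seat p04 GEN 7; stage A3)

HONEST FRAMING (cell `b2b-bsdres`, run/shared/lean/b2b/bsd-rank1-residual/, verbatim in every
file): the goal of the cell is to DELETE the COMBINATION-SHAPED residual classes of the
Birch–Swinnerton-Dyer formula for ALL analytic-rank `≤ 1` elliptic curves over `ℚ` — "full BSD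
formula for every rank `≤ 1` curve in class `C`" assembled STRICTLY from published theorems — so
that the rank-`≤ 1` remainder becomes exactly the CONSTRUCTION-SHAPED classes, which are TYPED
(missing-input `Prop`s), NOT attempted. This is not "finishing BSD". Team n1011 (N10 / N11, the
additive block X4 ∧ `p = 3`): research route; no claim beyond the stated classes; nothing is
booked; no mark / label is changed by this file. Theorems only (no definition, no named fact, no
`sorry`); TOOL theorems of the representation theory of finite groups.

## What

The lattice case of Milne, *ADT* I Lemma 2.12 (proof of Thm. 2.8, p. 34): for `ℤ[G]`-lattices
`W ≤ V` of finite index (`p^N V ≤ W`) without `p`-torsion, `[V/pV] = [W/pW]` in `R_{𝔽_p}(G)`;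
there it is applied to `R_L ⊇ (normal-basis lattice)`.  In the counting currency of stage A1
(`#Hom_G(Z, ·)`, `p ∤ #G`) and from the elementary step of stage A2
(`ModPRepCount.natCard_modP_mul_natCard_torsion_eq`, the case `pV ≤ W`):

* `ModPRepCount.nonempty_equiv_torsion`, `nonempty_equiv_modP` — `X[p]`, `X/p` are transported along
  equivalences of representations;
* `ModPRepCount.natCard_modP_mul_natCard_torsion_eq_of_le` — the step for a PAIR of stable subgroups
  `pW ≤ W' ≤ W ≤ V` (and `finite_quotient_range_lsmul_of_le_of_le`);
* `ModPRepCount.natCard_modP_eq_of_torsionFree_of_le` — **iteration**: if `V` has no `p`-torsion,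
  `W' ≤ W` are `G`-stable, `p^N W ≤ W'` and `W/pW` is finite, then `W'/pW'` is finite and
  `#Hom_G(Z, W/p) = #Hom_G(Z, W'/p)` (induction along `W' + p^j W`);
* `ModPRepCount.natCard_modP_eq_of_torsionFree` — the same with `W = V`.

Reference: J. S. Milne, *Arithmetic Duality Theorems*, 2nd ed. (2006), I §2, Lemma 2.12.
[MilneADT2006]
-/

noncomputable section

open Function

namespace Summit.BirchSwinnertonDyer.Rank1Residual.GaloisImage

namespace ModPRepCount

open Representation

variable {G : Type*} [Group G]
variable {V : Type*} [AddCommGroup V] (ρ : Representation ℤ G V) (p : ℕ)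

/-! ### Transport of `V[p]` and `V/p` -/

/-- **Transport of `V[p]`**: an equivalence of representations induces one on the `p`-torsion
subrepresentations. [folklore] -/
theorem nonempty_equiv_torsion {V' : Type*} [AddCommGroup V'] (ρ' : Representation ℤ G V')
    (e : ρ.Equiv ρ') :
    Nonempty ((ρ.subrepresentation _ (ker_lsmul_le_comap ρ p)).Equiv
      (ρ'.subrepresentation _ (ker_lsmul_le_comap ρ' p))) := by
  have h1 : ∀ v : LinearMap.ker (LinearMap.lsmul ℤ V p),
      e.toLinearEquiv (v : V) ∈ LinearMap.ker (LinearMap.lsmul ℤ V' p) := fun v => by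
    have hv := v.2
    simp only [LinearMap.mem_ker, LinearMap.lsmul_apply] at hv ⊢
    rw [← map_smul, hv, map_zero]
  have h2 : ∀ v : LinearMap.ker (LinearMap.lsmul ℤ V' p),
      e.toLinearEquiv.symm (v : V') ∈ LinearMap.ker (LinearMap.lsmul ℤ V p) := fun v => by
    have hv := v.2
    simp only [LinearMap.mem_ker, LinearMap.lsmul_apply] at hv ⊢
    rw [← map_smul, hv, map_zero]
  refine ⟨Representation.Equiv.mk
    { toFun := fun v => ⟨e.toLinearEquiv v, h1 v⟩
      invFun := fun v => ⟨e.toLinearEquiv.symm v, h2 v⟩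
      map_add' := fun v w => Subtype.ext (by simp)
      map_smul' := fun c v => Subtype.ext (by simp)
      left_inv := fun v => Subtype.ext (e.toLinearEquiv.symm_apply_apply _)
      right_inv := fun v => Subtype.ext (e.toLinearEquiv.apply_symm_apply _) } fun g => ?_⟩
  refine LinearMap.ext fun v => Subtype.ext ?_
  have h := IntertwiningMap.isIntertwining ρ ρ' e.toIntertwiningMap g (v : V)
  simpa using h

/-- **Transport of `V/p`**: an equivalence of representations induces one on the quotients
modulo `p`. [folklore] -/
theorem nonempty_equiv_modP {V' : Type*} [AddCommGroup V'] (ρ' : Representation ℤ G V')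
    (e : ρ.Equiv ρ') :
    Nonempty ((ρ.quotient _ (range_lsmul_le_comap ρ p)).Equiv
      (ρ'.quotient _ (range_lsmul_le_comap ρ' p))) := by
  have hmap : Submodule.map e.toLinearEquiv.toLinearMap (LinearMap.range (LinearMap.lsmul ℤ V p)) =
      LinearMap.range (LinearMap.lsmul ℤ V' p) := by
    ext x
    simp only [Submodule.mem_map, LinearMap.mem_range, LinearMap.lsmul_apply]
    constructor
    · rintro ⟨_, ⟨v, rfl⟩, rfl⟩
      exact ⟨e.toLinearEquiv v, (map_smul e.toLinearEquiv.toLinearMap (p : ℤ) v).symm⟩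
    · rintro ⟨v', rfl⟩
      refine ⟨(p : ℤ) • e.toLinearEquiv.symm v', ⟨_, rfl⟩, ?_⟩
      rw [map_smul]
      exact congrArg _ (e.toLinearEquiv.apply_symm_apply v')
  let q : (V ⧸ LinearMap.range (LinearMap.lsmul ℤ V p)) ≃ₗ[ℤ] (V' ⧸ LinearMap.range (LinearMap.lsmul ℤ V' p)) :=
    Submodule.Quotient.equiv _ _ e.toLinearEquiv hmap
  refine ⟨Representation.Equiv.mk q fun g => ?_⟩
  refine LinearMap.ext fun x => ?_
  obtain ⟨v, rfl⟩ := Submodule.mkQ_surjective _ x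
  change q (ρ.quotient _ (range_lsmul_le_comap ρ p) g (Submodule.Quotient.mk v)) =
    ρ'.quotient _ (range_lsmul_le_comap ρ' p) g (q (Submodule.Quotient.mk v))
  simp only [Representation.quotient_apply, Submodule.mapQ_apply, q]
  have h := IntertwiningMap.isIntertwining ρ ρ' e.toIntertwiningMap g v
  simp only [Representation.Equiv.coe_toIntertwiningMap] at h
  exact congrArg _ h

/-- `#Hom_G(Z, B) = 1` for a trivial (subsingleton) target. [folklore] -/
theorem natCard_intertwiningMap_of_subsingleton {Z : Type*} [AddCommGroup Z] (σ : Representation ℤ G Z)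
    {B : Type*} [AddCommGroup B] (β : Representation ℤ G B) [Subsingleton B] :
    Nat.card (IntertwiningMap σ β) = 1 := by
  haveI : Subsingleton (IntertwiningMap σ β) := ⟨fun f g => DFunLike.ext _ _ fun z => Subsingleton.elim _ _⟩
  exact Nat.card_unique

/-! ### Pull-backs, torsion-freeness, images -/

/-- The pull-back `W' ∩ W ⊆ W` (as a subgroup of `W`) of a stable subgroup is stable. [folklore] -/
theorem comap_subtype_le_comap (W W' : Submodule ℤ V) (hW : ∀ g, W ≤ W.comap (ρ g))
    (hW' : ∀ g, W' ≤ W'.comap (ρ g)) (g : G) :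
    W'.comap W.subtype ≤ (W'.comap W.subtype).comap (ρ.subrepresentation W hW g) := by
  intro w hw
  exact hW' g hw

/-- The equivalence `(W' ∩ W ⊆ W) ≃ W'` of representations for `W' ≤ W`. [folklore] -/
theorem nonempty_equiv_comap_subtype (W W' : Submodule ℤ V) (hW : ∀ g, W ≤ W.comap (ρ g))
    (hW' : ∀ g, W' ≤ W'.comap (ρ g)) (hle : W' ≤ W) :
    Nonempty (((ρ.subrepresentation W hW).subrepresentation (W'.comap W.subtype)
      (comap_subtype_le_comap ρ W W' hW hW')).Equiv (ρ.subrepresentation W' hW')) :=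
  ⟨Representation.Equiv.mk (Submodule.comapSubtypeEquivOfLe hle) fun _ =>
    LinearMap.ext fun _ => Subtype.ext rfl⟩

/-- `W'/p` is finite when `W/p` is and `pW ≤ W' ≤ W`. [folklore] -/
theorem finite_quotient_range_lsmul_of_le_of_le (W W' : Submodule ℤ V) (hW : ∀ g, W ≤ W.comap (ρ g))
    (hW' : ∀ g, W' ≤ W'.comap (ρ g)) (hle : W' ≤ W) (hpW : ∀ w ∈ W, (p : ℤ) • w ∈ W')
    [Finite (W ⧸ LinearMap.range (LinearMap.lsmul ℤ W p))] :
    Finite (W' ⧸ LinearMap.range (LinearMap.lsmul ℤ W' p)) := by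
  have hpW'' : ∀ w : W, (p : ℤ) • w ∈ W'.comap W.subtype := fun w => by
    change (((p : ℤ) • w : W) : V) ∈ W'
    rw [Submodule.coe_smul_of_tower]
    exact hpW w w.2
  haveI := finite_quotient_range_lsmul_of_le p (W'.comap W.subtype) hpW''
  obtain ⟨e⟩ := nonempty_equiv_comap_subtype ρ W W' hW hW' hle
  obtain ⟨eQ⟩ := nonempty_equiv_modP _ p _ e
  exact Finite.of_equiv _ eQ.toLinearEquiv.toEquiv

/-- A stable subgroup of a `p`-torsion-free module has trivial `p`-torsion. [folklore] -/
theorem subsingleton_ker_lsmul_of_torsionFree (htf : ∀ v : V, (p : ℤ) • v = 0 → v = 0)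
    (W : Submodule ℤ V) : Subsingleton (LinearMap.ker (LinearMap.lsmul ℤ W p)) := by
  refine ⟨fun a b => Subtype.ext (Subtype.ext ?_)⟩
  have ha : ((a : W) : V) = 0 := htf _ (by
    have h := a.2
    rw [LinearMap.mem_ker, LinearMap.lsmul_apply] at h
    have h' := congrArg (fun t : W => (t : V)) h
    simpa only [Submodule.coe_smul_of_tower, Submodule.coe_zero] using h')
  have hb : ((b : W) : V) = 0 := htf _ (by
    have h := b.2
    rw [LinearMap.mem_ker, LinearMap.lsmul_apply] at h
    have h' := congrArg (fun t : W => (t : V)) h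
    simpa only [Submodule.coe_smul_of_tower, Submodule.coe_zero] using h')
  rw [ha, hb]

/-- The image `p^N W` of a stable subgroup is stable. [folklore] -/
theorem map_lsmul_le_comap (W : Submodule ℤ V) (hW : ∀ g, W ≤ W.comap (ρ g)) (c : ℤ) (g : G) :
    W.map (LinearMap.lsmul ℤ V c) ≤ (W.map (LinearMap.lsmul ℤ V c)).comap (ρ g) := by
  rintro _ ⟨w, hw, rfl⟩
  refine ⟨ρ g w, hW g hw, ?_⟩
  simp only [LinearMap.lsmul_apply]
  rw [LinearMap.map_smul_of_tower]


/-! ### The step for a pair of stable subgroups `pW ≤ W' ≤ W ≤ V` -/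

section Pair

variable {p} [hp : Fact p.Prime] [Finite G]
variable {Z : Type*} [AddCommGroup Z] [Finite Z] (σ : Representation ℤ G Z)

/-- **Milne I Lemma 2.12, elementary step for a pair**: for `G`-stable subgroups `W' ≤ W` of `V`
with `pW ≤ W'` (`p ∤ #G`, `Z` killed by `p`):
`#Hom_G(Z, W/p) · #Hom_G(Z, W'[p]) = #Hom_G(Z, W'/p) · #Hom_G(Z, W[p])`.
[cite: MilneADT2006, I §2 Lemma 2.12] -/
theorem natCard_modP_mul_natCard_torsion_eq_of_le (hG : ¬ p ∣ Nat.card G) (hZ : ∀ z : Z, p • z = 0)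
    (W W' : Submodule ℤ V) (hW : ∀ g, W ≤ W.comap (ρ g)) (hW' : ∀ g, W' ≤ W'.comap (ρ g))
    (hle : W' ≤ W) (hpW : ∀ w ∈ W, (p : ℤ) • w ∈ W')
    [Finite (LinearMap.ker (LinearMap.lsmul ℤ W p))]
    [Finite (W ⧸ LinearMap.range (LinearMap.lsmul ℤ W p))] :
    Nat.card (IntertwiningMap σ ((ρ.subrepresentation W hW).quotient _
        (range_lsmul_le_comap (ρ.subrepresentation W hW) p))) *
      Nat.card (IntertwiningMap σ ((ρ.subrepresentation W' hW').subrepresentation _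
        (ker_lsmul_le_comap (ρ.subrepresentation W' hW') p))) =
    Nat.card (IntertwiningMap σ ((ρ.subrepresentation W' hW').quotient _
        (range_lsmul_le_comap (ρ.subrepresentation W' hW') p))) *
      Nat.card (IntertwiningMap σ ((ρ.subrepresentation W hW).subrepresentation _
        (ker_lsmul_le_comap (ρ.subrepresentation W hW) p))) := by
  set ρW := ρ.subrepresentation W hW with hρW
  set ρW' := ρ.subrepresentation W' hW' with hρW'
  have hpW'' : ∀ w : W, (p : ℤ) • w ∈ W'.comap W.subtype := fun w => by
    change (((p : ℤ) • w : W) : V) ∈ W'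
    rw [Submodule.coe_smul_of_tower]
    exact hpW w w.2
  set ρ'' := ρW.subrepresentation (W'.comap W.subtype) (comap_subtype_le_comap ρ W W' hW hW') with hρ''
  have step : Nat.card (IntertwiningMap σ (ρW.quotient _ (range_lsmul_le_comap ρW p))) *
      Nat.card (IntertwiningMap σ (ρ''.subrepresentation _ (ker_lsmul_le_comap ρ'' p))) =
    Nat.card (IntertwiningMap σ (ρ''.quotient _ (range_lsmul_le_comap ρ'' p))) *
      Nat.card (IntertwiningMap σ (ρW.subrepresentation _ (ker_lsmul_le_comap ρW p))) :=
    natCard_modP_mul_natCard_torsion_eq ρW σ hG hZ (W'.comap W.subtype)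
      (comap_subtype_le_comap ρ W W' hW hW') hpW''
  obtain ⟨e⟩ := nonempty_equiv_comap_subtype ρ W W' hW hW' hle
  obtain ⟨eT⟩ := nonempty_equiv_torsion ρ'' p ρW' e
  obtain ⟨eQ⟩ := nonempty_equiv_modP ρ'' p ρW' e
  have t1 : Nat.card (IntertwiningMap σ (ρ''.subrepresentation _ (ker_lsmul_le_comap ρ'' p))) =
      Nat.card (IntertwiningMap σ (ρW'.subrepresentation _ (ker_lsmul_le_comap ρW' p))) :=
    natCard_intertwiningMap_congr_right σ _ _ eT
  have t2 : Nat.card (IntertwiningMap σ (ρ''.quotient _ (range_lsmul_le_comap ρ'' p))) =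
      Nat.card (IntertwiningMap σ (ρW'.quotient _ (range_lsmul_le_comap ρW' p))) :=
    natCard_intertwiningMap_congr_right σ _ _ eQ
  rw [t1, t2] at step
  exact step

/-! ### Iteration along `W' + p^j W` in the torsion-free case -/

/-- **Milne I Lemma 2.12, lattice case, iterated**: let `V` be a `ℤ[G]`-module without
`p`-torsion, `W' ≤ W` `G`-stable subgroups with `p^N W ≤ W'`, `W/pW` finite, `p ∤ #G`, `Z` killed
by `p`.  Then `W'/pW'` is finite and `#Hom_G(Z, W/p) = #Hom_G(Z, W'/p)` — i.e. `[W/pW] = [W'/pW']`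
in `R_{𝔽_p}(G)` ("`[R_L^{(p)}] = [K:ℚ_p][𝔽_p[G]]`" is obtained from this with `W' =` a
normal-basis lattice). [cite: MilneADT2006, I §2 Lemma 2.12] -/
theorem natCard_modP_eq_of_torsionFree_of_le (hG : ¬ p ∣ Nat.card G) (hZ : ∀ z : Z, p • z = 0)
    (htf : ∀ v : V, (p : ℤ) • v = 0 → v = 0) (W : Submodule ℤ V) (hW : ∀ g, W ≤ W.comap (ρ g))
    [Finite (W ⧸ LinearMap.range (LinearMap.lsmul ℤ W p))] :
    ∀ (N : ℕ) (W' : Submodule ℤ V) (hW' : ∀ g, W' ≤ W'.comap (ρ g)), W' ≤ W →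
      (∀ w ∈ W, (p : ℤ) ^ N • w ∈ W') →
      Finite (W' ⧸ LinearMap.range (LinearMap.lsmul ℤ W' p)) ∧
      Nat.card (IntertwiningMap σ ((ρ.subrepresentation W hW).quotient _
          (range_lsmul_le_comap (ρ.subrepresentation W hW) p))) =
        Nat.card (IntertwiningMap σ ((ρ.subrepresentation W' hW').quotient _
          (range_lsmul_le_comap (ρ.subrepresentation W' hW') p))) := by
  intro N
  induction N with
  | zero =>
    intro W' hW' hle hpN
    obtain rfl : W' = W := le_antisymm hle fun w hw => by simpa using hpN w hw
    exact ⟨inferInstance, rfl⟩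
  | succ N ih =>
    intro W' hW' hle hpN
    -- `W₁ = W' + p^N W`
    let W₁ : Submodule ℤ V := W' ⊔ W.map (LinearMap.lsmul ℤ V ((p : ℤ) ^ N))
    have hW₁ : ∀ g, W₁ ≤ W₁.comap (ρ g) := fun g => sup_le
      (fun w hw => Submodule.mem_sup_left (hW' g hw))
      (fun w hw => Submodule.mem_sup_right (map_lsmul_le_comap ρ W hW _ g hw))
    have hle₁ : W₁ ≤ W := sup_le hle (by
      rintro _ ⟨_, hw, rfl⟩
      exact W.smul_mem _ hw)
    have hpN₁ : ∀ w ∈ W, (p : ℤ) ^ N • w ∈ W₁ := fun w hw =>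
      Submodule.mem_sup_right ⟨w, hw, rfl⟩
    have hle' : W' ≤ W₁ := le_sup_left
    have hpW₁ : ∀ w ∈ W₁, (p : ℤ) • w ∈ W' := fun w hw => by
      obtain ⟨a, ha, b, hb, rfl⟩ := Submodule.mem_sup.1 hw
      obtain ⟨c, hc, rfl⟩ := hb
      rw [smul_add]
      refine W'.add_mem (W'.smul_mem _ ha) ?_
      rw [LinearMap.lsmul_apply, smul_smul, ← pow_succ']
      exact hpN c hc
    obtain ⟨fin₁, eq₁⟩ := ih W₁ hW₁ hle₁ hpN₁
    haveI := fin₁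
    haveI : Finite (LinearMap.ker (LinearMap.lsmul ℤ W₁ p)) := by
      haveI := subsingleton_ker_lsmul_of_torsionFree p htf W₁
      infer_instance
    haveI := subsingleton_ker_lsmul_of_torsionFree p htf W₁
    haveI := subsingleton_ker_lsmul_of_torsionFree p htf W'
    refine ⟨finite_quotient_range_lsmul_of_le_of_le ρ p W₁ W' hW₁ hW' hle' hpW₁, ?_⟩
    have step := natCard_modP_mul_natCard_torsion_eq_of_le ρ σ hG hZ W₁ W' hW₁ hW' hle' hpW₁
    rw [natCard_intertwiningMap_of_subsingleton, natCard_intertwiningMap_of_subsingleton, mul_one,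
      mul_one] at step
    exact eq₁.trans step

/-- **Milne I Lemma 2.12, lattice case**: for a `ℤ[G]`-module `V` without `p`-torsion with `V/pV`
finite, a `G`-stable subgroup `W` with `p^N V ≤ W`, `p ∤ #G` and `Z` killed by `p`:
`#Hom_G(Z, V/p) = #Hom_G(Z, W/p)`. [cite: MilneADT2006, I §2 Lemma 2.12] -/
theorem natCard_modP_eq_of_torsionFree (hG : ¬ p ∣ Nat.card G) (hZ : ∀ z : Z, p • z = 0)
    (htf : ∀ v : V, (p : ℤ) • v = 0 → v = 0) (W : Submodule ℤ V) (hW : ∀ g, W ≤ W.comap (ρ g))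
    {N : ℕ} (hpN : ∀ v : V, (p : ℤ) ^ N • v ∈ W)
    [Finite (V ⧸ LinearMap.range (LinearMap.lsmul ℤ V p))] :
    Nat.card (IntertwiningMap σ (ρ.quotient _ (range_lsmul_le_comap ρ p))) =
      Nat.card (IntertwiningMap σ ((ρ.subrepresentation W hW).quotient _
        (range_lsmul_le_comap (ρ.subrepresentation W hW) p))) := by
  -- transport `V ≃ ⊤`
  have htop : ∀ g, (⊤ : Submodule ℤ V) ≤ (⊤ : Submodule ℤ V).comap (ρ g) := fun _ _ _ => trivial
  have e : ρ.Equiv (ρ.subrepresentation ⊤ htop) :=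
    Representation.Equiv.mk (Submodule.topEquiv.symm) fun g => LinearMap.ext fun v => Subtype.ext rfl
  obtain ⟨eQ⟩ := nonempty_equiv_modP ρ p _ e
  haveI : Finite ((⊤ : Submodule ℤ V) ⧸ LinearMap.range (LinearMap.lsmul ℤ (⊤ : Submodule ℤ V) p)) :=
    Finite.of_equiv _ eQ.toLinearEquiv.toEquiv
  have t0 : Nat.card (IntertwiningMap σ (ρ.quotient _ (range_lsmul_le_comap ρ p))) =
      Nat.card (IntertwiningMap σ ((ρ.subrepresentation ⊤ htop).quotient _
        (range_lsmul_le_comap (ρ.subrepresentation ⊤ htop) p))) :=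
    natCard_intertwiningMap_congr_right σ _ _ eQ
  rw [t0]
  exact (natCard_modP_eq_of_torsionFree_of_le ρ σ hG hZ htf ⊤ htop N W hW le_top
    (fun w _ => hpN w)).2

end Pair

end ModPRepCount

end Summit.BirchSwinnertonDyer.Rank1Residual.GaloisImage

end
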